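import Literature.Probability.Percolation.CrossingClusterBlockEstimate
import Literature.Probability.Percolation.CrossingClusterSecondMoment
import Literature.Probability.Percolation.FourArmGarbanAssembly
import HarnessLib

/-!
# Garban's multi-scale four-arm bound: the discharge, without arm separation

Topic `Literature/Probability/Percolation`. This file PROVES the named fact
`Literature.Probability.Percolation.Garban2011_fourArm_multiscale` (`FourArmGarban.lean`):
**for critical bond percolation on `ℤ²`, `π₂(m,n) ≤ c'(m/n)^{2ε}` for all `1 ≤ m ≤ n` implies
`π₄(m,n) ≤ c (m/n)^{1+ε}` for all `1 ≤ m ≤ n`** (C. Garban, Appendix B of O. Schramm, S. Smirnov,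
*On the scaling limits of planar percolation*, Ann. Probab. 39 (2011), Lemma B.1; restated as
Lemma 8 of J. van den Berg, P. Nolin, Progr. Probab. 77 (2020)).

The printed proofs use Kesten's arm-separation theory at the mesoscopic scale `m` ((B.2) and
(B.4) of Garban; van den Berg–Nolin, §5.1: "we do not see how to avoid that result in the proof of
Lemma 8 for a general `m ≥ 1`"). The proof formalised in the tree avoids it, by combining the two
printed proofs with one change of geometry:

* van den Berg–Nolin's functional `Z` = number of open clusters of `B(M)` joining `B(N)` to the
  sphere `‖·‖_∞ = M` (`CrossingClusterCount.lean`, `E[Z²] ≤ 3`: `CrossingClusterSecondMoment.lean`)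
  in place of Garban's crossing indicator, so that four arms landing ANYWHERE make a block pivotal;
* Garban's circuit bits, re-weighted `w_j = 1_{Δ_j}/P(Δ_j) - 1_{O_j}/P(O_j)` (mean zero without
  exact self-duality), with the pivotal block `j + B(m)` INSIDE the circuit annulus
  `S_j = j + A_{m+2, 2m+2}`, so that docking is automatic and Harris's inequality inside the block
  gives `E[Z w_j] ≥ P⁴(m, n)` (`CrossingClusterBlockEstimate.lean`);
* the boundary-interface explorer of `B(M)` (`BoundaryExplorer.lean`) as the decision tree: a
  pivotal block is examined (`BoundaryExplorerInterface.lean`, `BoundaryExplorerRevealment.lean`,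
  Jordan-free via the parity lemma of `LatticeFaceParity.lean`) and an examined block carries two
  arms, `P(Y_j) ≤ π₂(2m+5, M-N-1)`;
* the revealment/orthogonality identities (B.5)–(B.7) (`RevealmentOrthogonality.lean`) and the
  Cauchy–Schwarz assembly of `GarbanScheme` (`FourArmGarbanAssembly.lean`).

`nonempty_garbanScheme` builds the scheme at every pair of scales `n ≥ C₀ m`, and
`Garban2011_fourArm_multiscale_holds` is the discharge.

## References

* O. Schramm, S. Smirnov (appendix by C. Garban), Ann. Probab. 39 (2011), Appendix B, Lemma B.1
  and its proof, (B.2)–(B.8) [SchrammSmirnov2011].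
* J. van den Berg, P. Nolin, Progr. Probab. 77 (2020) = arXiv:2008.01606, §4.3 Lemma 8, §5
  [VandenbergNolin2020].

Tree: `GarbanScheme`, `Garban2011_fourArm_multiscale_of_scheme` (`FourArmGarbanAssembly.lean`),
`exists_integral_numCrossingClusters_sq_le` (`CrossingClusterSecondMoment.lean`),
`exists_pos_le_real_openCircuitInAnnulusAt`, `exists_pos_le_real_dualCircuitInAnnulusAt_half`
(`ThinAnnulusCircuits.lean`), `le_integral_mul_circuitWeight` (`CrossingClusterBlockEstimate.lean`),
`exists_mem_supp_of_pivotal`, `real_setOf_exists_mem_supp_le_twoArmOpenDual`, `blockPairs`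
(`BoundaryExplorerRevealment.lean`), `boundaryExplorer_fresh`, `termTime` (`BoundaryExplorer.lean`),
`Explorer.integral_revealedBits_mul_eq_zero`, `Explorer.integral_indicator_pivotal_mul_bit_eq_setIntegral_revealed`,
`integral_mul_bit_eq_integral_indicator_pivotal` (`RevealmentOrthogonality.lean`),
`real_fourArmTwoClustersAt` (`FourArmGarbanShift.lean`).
-/

noncomputable section

namespace Literature.Probability.Percolation

open _root_.MeasureTheory Set LatticeModels ProbeHistory
open scoped Classical

/-! ### The grid of centres -/

/-- The centre with grid index `k`: `(d (k₁ - L), d (k₂ - L))`. [cite: SchrammSmirnov2011, Appendix B, proof of Lemma B.1 (the squares Q_j)] -/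
def gridCentre (d L : ℕ) (k : Fin (2 * L + 1) × Fin (2 * L + 1)) : Site 2 :=
  ![(d : ℤ) * ((k.1 : ℕ) - (L : ℤ)), (d : ℤ) * ((k.2 : ℕ) - (L : ℤ))]

/-- **The centres `c_j` of the mesoscopic blocks**: the points of `d ℤ²` with coordinates of
absolute value at most `d L` ("cut the concentric square into `r × r` squares `Q_j`"). [cite: SchrammSmirnov2011, Appendix B, proof of Lemma B.1 (the squares Q_j)] -/
def gridCentres (d L : ℕ) : Finset (Site 2) := Finset.univ.image (gridCentre d L)

/-- Coordinates of a grid centre. [folklore] -/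
theorem gridCentre_apply_zero (d L : ℕ) (k : Fin (2 * L + 1) × Fin (2 * L + 1)) :
    gridCentre d L k 0 = (d : ℤ) * ((k.1 : ℕ) - (L : ℤ)) := rfl

/-- Coordinates of a grid centre. [folklore] -/
theorem gridCentre_apply_one (d L : ℕ) (k : Fin (2 * L + 1) × Fin (2 * L + 1)) :
    gridCentre d L k 1 = (d : ℤ) * ((k.2 : ℕ) - (L : ℤ)) := rfl

/-- The centre map is injective for a positive spacing. [folklore] -/
theorem gridCentre_injective {d : ℕ} (hd : 1 ≤ d) (L : ℕ) : Function.Injective (gridCentre d L) := by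
  intro k k' h
  have h0 := congr_fun h 0
  have h1 := congr_fun h 1
  rw [gridCentre_apply_zero, gridCentre_apply_zero] at h0
  rw [gridCentre_apply_one, gridCentre_apply_one] at h1
  have hd0 : (d : ℤ) ≠ 0 := by exact_mod_cast (show d ≠ 0 by omega)
  have e0 := mul_left_cancel₀ hd0 h0
  have e1 := mul_left_cancel₀ hd0 h1
  refine Prod.ext (Fin.ext ?_) (Fin.ext ?_)
  · have : ((k.1 : ℕ) : ℤ) = (k'.1 : ℕ) := by linarith
    exact_mod_cast this
  · have : ((k.2 : ℕ) : ℤ) = (k'.2 : ℕ) := by linarith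
    exact_mod_cast this

/-- There are `(2L+1)²` centres. [folklore] -/
theorem card_gridCentres {d : ℕ} (hd : 1 ≤ d) (L : ℕ) : (gridCentres d L).card = (2 * L + 1) ^ 2 := by
  rw [gridCentres, Finset.card_image_of_injective _ (gridCentre_injective hd L), Finset.card_univ,
    Fintype.card_prod, Fintype.card_fin, sq]

/-- Coordinates of the centres are at most `d L` in absolute value. [folklore] -/
theorem abs_apply_le_of_mem_gridCentres {d L : ℕ} {j : Site 2} (hj : j ∈ gridCentres d L) (i : Fin 2) :
    |j i| ≤ (d : ℤ) * L := by
  rw [gridCentres, Finset.mem_image] at hj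
  obtain ⟨k, -, rfl⟩ := hj
  have hk1 : ((k.1 : ℕ) : ℤ) ≤ 2 * L := by have := k.1.isLt; omega
  have hk2 : ((k.2 : ℕ) : ℤ) ≤ 2 * L := by have := k.2.isLt; omega
  have hd : (0 : ℤ) ≤ d := by positivity
  fin_cases i
  · show |gridCentre d L k 0| ≤ _
    rw [gridCentre_apply_zero, abs_mul, Nat.abs_cast]
    exact mul_le_mul_of_nonneg_left (abs_le.2 ⟨by omega, by omega⟩) hd
  · show |gridCentre d L k 1| ≤ _
    rw [gridCentre_apply_one, abs_mul, Nat.abs_cast]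
    exact mul_le_mul_of_nonneg_left (abs_le.2 ⟨by omega, by omega⟩) hd

/-- Distinct centres differ by at least the spacing `d` in some coordinate. [folklore] -/
theorem exists_le_abs_sub_of_mem_gridCentres {d L : ℕ} {j j' : Site 2} (hj : j ∈ gridCentres d L)
    (hj' : j' ∈ gridCentres d L) (hne : j ≠ j') : ∃ i : Fin 2, (d : ℤ) ≤ |j i - j' i| := by
  rw [gridCentres, Finset.mem_image] at hj hj'
  obtain ⟨k, -, rfl⟩ := hj
  obtain ⟨k', -, rfl⟩ := hj'
  have hd : (0 : ℤ) ≤ d := by positivity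
  by_cases h1 : k.1 = k'.1
  · have h2 : k.2 ≠ k'.2 := fun h2 => hne (by rw [Prod.ext h1 h2])
    refine ⟨1, ?_⟩
    rw [gridCentre_apply_one, gridCentre_apply_one, ← mul_sub, abs_mul, Nat.abs_cast]
    have : (1 : ℤ) ≤ |((k.2 : ℕ) : ℤ) - L - ((k'.2 : ℕ) - L)| := by
      have hne' : ((k.2 : ℕ) : ℤ) ≠ (k'.2 : ℕ) := fun h => h2 (Fin.ext (by exact_mod_cast h))
      rw [sub_sub_sub_cancel_right]
      exact Int.one_le_abs (sub_ne_zero.2 hne')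
    nlinarith
  · refine ⟨0, ?_⟩
    rw [gridCentre_apply_zero, gridCentre_apply_zero, ← mul_sub, abs_mul, Nat.abs_cast]
    have : (1 : ℤ) ≤ |((k.1 : ℕ) : ℤ) - L - ((k'.1 : ℕ) - L)| := by
      have hne' : ((k.1 : ℕ) : ℤ) ≠ (k'.1 : ℕ) := fun h => h1 (Fin.ext (by exact_mod_cast h))
      rw [sub_sub_sub_cancel_right]
      exact Int.one_le_abs (sub_ne_zero.2 hne')
    nlinarith

/-- **The blocks of distinct centres are disjoint** when the spacing is `2ρ + 1`. [folklore] -/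
theorem disjoint_blockPairs_of_mem_gridCentres {ρ L : ℕ} {j j' : Site 2} (hj : j ∈ gridCentres (2 * ρ + 1) L)
    (hj' : j' ∈ gridCentres (2 * ρ + 1) L) (hne : j ≠ j') : Disjoint (blockPairs j ρ) (blockPairs j' ρ) := by
  rw [Finset.disjoint_left]
  intro e he he'
  rw [mem_blockPairs_iff] at he he'
  obtain ⟨i, hi⟩ := exists_le_abs_sub_of_mem_gridCentres hj hj' hne
  induction e using Sym2.ind with
  | h x y =>
    have h1 := (mem_box.1 (he x (Sym2.mem_mk_left _ _))) i
    have h2 := (mem_box.1 (he' x (Sym2.mem_mk_left _ _))) i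
    simp only [Pi.sub_apply] at h1 h2
    push_cast at hi
    cases abs_cases (j i - j' i) <;> omega

/-! ### The lower bound `E[Z w_j ; Y_j] ≥ P⁴` for one block -/

/-- **The re-weighted circuit bit as a function of the observation on the block**:
`w(o) = 1_Δ(o)/pΔ - 1_O(o)/pO` for `o` a set of pairs of `j + B(b'+1)`. [cite: SchrammSmirnov2011, Appendix B, proof of Lemma B.1 (definition of C_j)] -/
def circuitWeight (j : Site 2) (a' b' : ℕ) (pO pD : ℝ) (o : Finset (Sym2 (Site 2))) : ℝ :=
  (if (↑o : Set (Sym2 (Site 2))) ∈ dualCircuitInAnnulusAt j a' b' then (1 : ℝ) else 0) / pD -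
    (if (↑o : Set (Sym2 (Site 2))) ∈ openCircuitInAnnulusAt j a' b' then (1 : ℝ) else 0) / pO

/-- **The weight read off the block is the weight of the configuration**: the circuit events are
determined by the pairs of `j + B(b'+1)`. [folklore] -/
theorem circuitWeight_obs (j : Site 2) (a' b' : ℕ) (pO pD : ℝ) (ω : BondConfig (Site 2)) :
    circuitWeight j a' b' pO pD (obs ω (blockPairs j (b' + 1))) =
      (dualCircuitInAnnulusAt j a' b').indicator 1 ω / pD - (openCircuitInAnnulusAt j a' b').indicator 1 ω / pO := by
  have hsub : blockPairs j b' ⊆ blockPairs j (b' + 1) := fun e he =>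
    mem_blockPairs_iff.2 fun v hv => box_mono 2 (Nat.le_succ _) (mem_blockPairs_iff.1 he v hv)
  have hOT : DeterminedBy (openCircuitInAnnulusAt j a' b') (↑(blockPairs j (b' + 1)) : Set (Sym2 (Site 2))) :=
    (determinedBy_openCircuitInAnnulusAt j a' b').mono (Finset.coe_subset.2 hsub)
  have hDT : DeterminedBy (dualCircuitInAnnulusAt j a' b') (↑(blockPairs j (b' + 1)) : Set (Sym2 (Site 2))) :=
    (determinedBy_dualCircuitInAnnulusAt j a' b').mono (dualEdge_preimage_blockPairs_subset j b')
  unfold circuitWeight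
  rw [← mem_iff_obs_mem_of_determinedBy hOT ω, ← mem_iff_obs_mem_of_determinedBy hDT ω]
  simp only [Set.indicator_apply, Pi.one_apply]

/-- The weight is bounded by `1/ρ` when both circuit probabilities are at least `ρ > 0`. [folklore] -/
theorem abs_circuitWeight_le {j : Site 2} {a' b' : ℕ} {pO pD ρs : ℝ} (hρ : 0 < ρs) (hO : ρs ≤ pO)
    (hD : ρs ≤ pD) (o : Finset (Sym2 (Site 2))) : |circuitWeight j a' b' pO pD o| ≤ 1 / ρs := by
  unfold circuitWeight
  have hO' : 1 / pO ≤ 1 / ρs := one_div_le_one_div_of_le hρ hO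
  have hD' : 1 / pD ≤ 1 / ρs := one_div_le_one_div_of_le hρ hD
  have hpO : 0 < 1 / pO := by have : 0 < pO := hρ.trans_le hO; positivity
  have hpD : 0 < 1 / pD := by have : 0 < pD := hρ.trans_le hD; positivity
  split_ifs <;> rw [abs_le] <;> constructor <;>
    first | linarith | (simp only [zero_div, one_div] at *; linarith)

/-- The weight has mean zero (`pO`, `pD` the actual probabilities). [cite: SchrammSmirnov2011, Appendix B, proof of Lemma B.1, (B.3) E[C_j] = 0] -/
theorem integral_circuitWeight_obs {j : Site 2} {a' b' : ℕ} {pO pD : ℝ}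
    (hpO : pO = (bondPercolation (zdGraph 2) half).real (openCircuitInAnnulusAt j a' b')) (hpO0 : 0 < pO)
    (hpD : pD = (bondPercolation (zdGraph 2) half).real (dualCircuitInAnnulusAt j a' b')) (hpD0 : 0 < pD) :
    ∫ ω, circuitWeight j a' b' pO pD (obs ω (blockPairs j (b' + 1))) ∂(bondPercolation (zdGraph 2) half) = 0 := by
  set μ := bondPercolation (zdGraph 2) half with hμ
  simp_rw [circuitWeight_obs]
  have hOm := measurableSet_openCircuitInAnnulusAt j a' b'
  have hDm := measurableSet_dualCircuitInAnnulusAt j a' b'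
  have hint : ∀ {A : Set (BondConfig (Site 2))}, MeasurableSet A → ∀ c : ℝ,
      Integrable (fun ω => A.indicator (1 : BondConfig (Site 2) → ℝ) ω / c) μ := by
    intro A hA c
    refine Integrable.of_bound ((measurable_one.indicator hA).div_const c).aestronglyMeasurable |1 / c|
      (ae_of_all _ fun ω => ?_)
    rw [Real.norm_eq_abs, abs_div, abs_div, abs_one, Set.indicator_apply, Pi.one_apply]
    split_ifs <;> simp
  rw [integral_sub (hint hDm pD) (hint hOm pO), integral_div, integral_div, integral_indicator_one hDm,
    integral_indicator_one hOm, ← hpO, ← hpD, div_self hpD0.ne', div_self hpO0.ne', sub_self]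

/-- **`P⁴ ≤ E[Z w_j ; Y_j]` for one block** (Garban's (B.2), (B.4), (B.5), (B.7) — the chain
`P⁴ ≲ P[Q_j pivotal] ≲ E[X C_j] = E[X C_j Y_j]` — for the cluster count `Z`, the re-weighted bit
`w_j` read off `Q_j = j + B(b'+1)`, the pivotal hole `j + B(h)` inside the circuit annulus
`j + A_{a',b'}` (`1 ≤ h`, `h + 2 ≤ a' ≤ b'`, `Q_j ⊆ B(N)`, `N < M`, `b' + 2 + |j i| ≤ M`), the
four-arm event `fourArmTwoClustersAt j h n₄` (`n₄ ≥ M + |j i|`) and the revealment event `Y_j` of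
`Q_j` by the boundary explorer of `B(M)`): no arm separation is used. [cite: SchrammSmirnov2011, Appendix B, proof of Lemma B.1, (B.2)-(B.7)] -/
theorem real_fourArm_le_setIntegral_mul_circuitWeight {N M : ℕ} (hNM : N < M) {j : Site 2}
    {h a' b' n₄ : ℕ} (hh : 1 ≤ h) (hha : h + 2 ≤ a') (hab : a' ≤ b')
    (hV : ∀ x, x - j ∈ box 2 (b' + 1) → x ∈ box 2 N) (hb : ∀ i, (b' : ℤ) + 2 + |j i| ≤ M)
    (hn : ∀ i, (M : ℤ) + |j i| ≤ n₄) {pO pD : ℝ}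
    (hpO : pO = (bondPercolation (zdGraph 2) half).real (openCircuitInAnnulusAt j a' b')) (hpO0 : 0 < pO)
    (hpD : pD = (bondPercolation (zdGraph 2) half).real (dualCircuitInAnnulusAt j a' b')) (hpD0 : 0 < pD) :
    (bondPercolation (zdGraph 2) half).real (fourArmTwoClustersAt j h n₄) ≤
      ∫ ω in {ω | ∃ e ∈ blockPairs j (b' + 1), e ∈ supp ((boundaryExplorer M).hist (termTime M) ω)},
        (numCrossingClusters ω N M : ℝ) * circuitWeight j a' b' pO pD (obs ω (blockPairs j (b' + 1)))
        ∂(bondPercolation (zdGraph 2) half) := by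
  set μ := bondPercolation (zdGraph 2) half with hμ
  set T := blockPairs j (b' + 1) with hT
  have hZm := measurable_numCrossingClusters_real N M
  have hZb : ∀ ω : BondConfig (Site 2), |(numCrossingClusters ω N M : ℝ)| ≤ (box 2 N).card := fun ω => by
    rw [Nat.abs_cast]; exact_mod_cast numCrossingClusters_le_card ω N M
  have h0 := integral_circuitWeight_obs hpO hpO0 hpD hpD0
  -- (B.5): only pivotal configurations contribute
  have hB5 := integral_mul_bit_eq_integral_indicator_pivotal (zdGraph 2) half T (circuitWeight j a' b' pO pD) h0 hZm hZb
  -- (B.7): pivotal blocks are examined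
  have hpiv : ∀ᵐ ω ∂μ, (∃ ξ ⊆ (↑T : Set (Sym2 (Site 2))),
      (numCrossingClusters (ω \ ↑T ∪ ξ) N M : ℝ) ≠ numCrossingClusters ω N M) →
      ∃ e ∈ T, e ∈ supp ((boundaryExplorer M).hist (termTime M) ω) := by
    filter_upwards [ae_subset_edgeSet (zdGraph 2) half] with ω hω hξ
    exact exists_mem_supp_of_pivotal hω hNM (by omega) hV hξ
  have hB7 := (boundaryExplorer M).integral_indicator_pivotal_mul_bit_eq_setIntegral_revealed (zdGraph 2) half
    (boundaryExplorer_fresh M) (termTime M) T (circuitWeight j a' b' pO pD) h0 hZm hZb hpiv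
  -- (B.2)+(B.4): the block estimate
  have hB4 := le_integral_mul_circuitWeight hNM hh hha hab hV hb hn hpO hpO0 hpD hpD0
  simp_rw [← circuitWeight_obs] at hB4
  rw [hB5, hB7] at hB4
  exact hB4

/-! ### The scheme at a pair of scales: arithmetic of the constants -/

/-- The count of blocks: `(2L+1)² ≥ (n/m)² / (44(K₀+1))²`. [folklore] -/
theorem card_bound_aux {K₀ N₀ m n N L ρ : ℕ} (hN₀ : 1 ≤ N₀) (hm : 1 ≤ m)
    (hmn : 200 * (K₀ + 1) * N₀ * m ≤ n) (hnN : n < (K₀ + 1) * (N + 1)) (hρ : ρ = 2 * m + 3)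
    (hL : N - ρ < (2 * ρ + 1) * (L + 1)) (hρN : ρ ≤ N) :
    1 / (44 * ((K₀ : ℝ) + 1)) ^ 2 * ((n : ℝ) / m) ^ 2 ≤ (((2 * L + 1) ^ 2 : ℕ) : ℝ) := by
  have hm0 : (0 : ℝ) < m := by exact_mod_cast hm
  have hK : (0 : ℝ) < (K₀ : ℝ) + 1 := by positivity
  -- real forms of the hypotheses
  have hA : (N : ℝ) - ρ < (2 * ρ + 1) * ((L : ℝ) + 1) := by
    have h' : ((N - ρ : ℕ) : ℝ) = (N : ℝ) - ρ := by push_cast [Nat.cast_sub hρN]; ring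
    rw [← h']; exact_mod_cast hL
  have hB : (n : ℝ) < ((K₀ : ℝ) + 1) * ((N : ℝ) + 1) := by exact_mod_cast hnN
  have hρ' : (ρ : ℝ) = 2 * m + 3 := by rw [hρ]; push_cast; ring
  have hm1 : (1 : ℝ) ≤ m := by exact_mod_cast hm
  have hL0 : (0 : ℝ) ≤ L := by positivity
  have hmn' : 200 * ((K₀ : ℝ) + 1) * m ≤ n := by
    have h1 : 200 * (K₀ + 1) * m ≤ 200 * (K₀ + 1) * N₀ * m := by
      have := Nat.mul_le_mul_left (200 * (K₀ + 1) * m) hN₀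
      nlinarith
    have h2 : 200 * (K₀ + 1) * m ≤ n := h1.trans hmn
    exact_mod_cast h2
  -- `11 m L ≥ N - 6m - 10`
  have hLm : (L : ℝ) ≤ m * L := le_mul_of_one_le_left hL0 hm1
  have h1 : (N : ℝ) - 6 * m - 10 ≤ 11 * (m * L) := by rw [hρ'] at hA; nlinarith
  -- multiply by `8 (K₀+1)`
  have h2 : 8 * ((K₀ : ℝ) + 1) * ((N : ℝ) - 6 * m - 10) ≤ 8 * ((K₀ : ℝ) + 1) * (11 * (m * L)) :=
    mul_le_mul_of_nonneg_left h1 (by positivity)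
  have h3 : ((K₀ : ℝ) + 1) ≤ ((K₀ : ℝ) + 1) * m := le_mul_of_one_le_right hK.le hm1
  -- the main inequality `n ≤ (2L+1) (44 (K₀+1) m)`
  have hmain : (n : ℝ) ≤ (2 * (L : ℝ) + 1) * (44 * ((K₀ : ℝ) + 1) * m) := by nlinarith
  have hq : (0 : ℝ) ≤ (n : ℝ) / (44 * ((K₀ : ℝ) + 1) * m) := by positivity
  have hL1 : (n : ℝ) / (44 * ((K₀ : ℝ) + 1) * m) ≤ 2 * (L : ℝ) + 1 := by
    rw [div_le_iff₀ (by positivity)]; exact hmain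
  calc 1 / (44 * ((K₀ : ℝ) + 1)) ^ 2 * ((n : ℝ) / m) ^ 2
      = ((n : ℝ) / (44 * ((K₀ : ℝ) + 1) * m)) ^ 2 := by field_simp
    _ ≤ (2 * (L : ℝ) + 1) ^ 2 := pow_le_pow_left₀ hq hL1 2
    _ = (((2 * L + 1) ^ 2 : ℕ) : ℝ) := by push_cast; ring

/-- The ratio of the two-arm radii: `(2m+5)/(M-N-1) ≤ 28 (K₀+1) m/n`. [folklore] -/
theorem ratio_bound_aux {K₀ N₀ m n N M : ℕ} (hK₀ : 2 ≤ K₀) (hN₀ : 1 ≤ N₀) (hm : 1 ≤ m)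
    (hmn : 200 * (K₀ + 1) * N₀ * m ≤ n) (hnN : n < (K₀ + 1) * (N + 1)) (hM : M = K₀ * N)
    (hN : 2 * m + 6 ≤ N) :
    (((2 * m + 5 : ℕ) : ℝ)) / ((M - N - 1 : ℕ) : ℝ) ≤ 28 * ((K₀ : ℝ) + 1) * m / n := by
  have hMN : N ≤ M - N := by
    obtain ⟨P, hP⟩ : ∃ P : ℕ, P = K₀ * N := ⟨_, rfl⟩
    have h2 : 2 * N ≤ P := by rw [hP]; exact Nat.mul_le_mul_right _ hK₀
    rw [← hP] at hM
    omega
  have hNM : N ≤ M := by omega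
  have hb1 : 1 ≤ M - N - 1 := by omega
  have hb0 : (0 : ℝ) < ((M - N - 1 : ℕ) : ℝ) := by exact_mod_cast hb1
  have hbN : (N : ℝ) - 1 ≤ ((M - N - 1 : ℕ) : ℝ) := by
    have : N - 1 ≤ M - N - 1 := by omega
    have h' : ((N - 1 : ℕ) : ℝ) = (N : ℝ) - 1 := by push_cast [Nat.cast_sub (show 1 ≤ N by omega)]; ring
    rw [← h']; exact_mod_cast this
  have hB : (n : ℝ) < ((K₀ : ℝ) + 1) * ((N : ℝ) + 1) := by exact_mod_cast hnN
  have hm1 : (1 : ℝ) ≤ m := by exact_mod_cast hm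
  have hK : (0 : ℝ) < (K₀ : ℝ) + 1 := by positivity
  have hmn' : 200 * ((K₀ : ℝ) + 1) * m ≤ n := by
    have h1 : 200 * (K₀ + 1) * m ≤ 200 * (K₀ + 1) * N₀ * m := by
      have := Nat.mul_le_mul_left (200 * (K₀ + 1) * m) hN₀
      nlinarith
    exact_mod_cast h1.trans hmn
  have hn0 : (0 : ℝ) < n := by nlinarith
  rw [div_le_div_iff₀ hb0 hn0]
  -- `(2m+5) n ≤ 28 (K₀+1) m (M-N-1)`
  set B : ℝ := ((M - N - 1 : ℕ) : ℝ) with hBdef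
  have h1 : ((K₀ : ℝ) + 1) * m * ((N : ℝ) - 1) ≤ ((K₀ : ℝ) + 1) * m * B :=
    mul_le_mul_of_nonneg_left hbN (by positivity)
  have h2 : (m : ℝ) * (n : ℝ) ≤ m * (((K₀ : ℝ) + 1) * ((N : ℝ) + 1)) :=
    mul_le_mul_of_nonneg_left hB.le (by positivity)
  have h3 : ((K₀ : ℝ) + 1) ≤ ((K₀ : ℝ) + 1) * m := le_mul_of_one_le_right hK.le hm1
  have h4 : (n : ℝ) ≤ m * n := le_mul_of_one_le_left hn0.le hm1
  push_cast
  nlinarith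

/-- **Garban's scheme without separation.** Data: a ratio `K₀ ≥ 2` and threshold `N₀ ≥ 1` with
`E_{1/2}[Z²] ≤ 3` for `Z` the number of open clusters of `B(K₀ N)` crossing from `B(N)`
(`N ≥ N₀`), and an RSW constant `ρ > 0` bounding from below the probabilities of open circuits of
`c + A_{a,b}` and of closed dual circuits of `(c + A_{a,b})*` whenever `2b ≤ 8(b - a)`. Then at all
scales `m ≥ 1`, `n ≥ 200 (K₀+1) N₀ m` there is a `GarbanScheme` with constants
`K₁ = 1/(44(K₀+1))²`, `K₂ = 2/ρ`, `K₃ = 1`, `K₄ = 28 (K₀+1)`: `X = Z/2` (`N = ⌊n/(K₀+1)⌋`,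
`M = K₀ N`), centres the grid of spacing `4m+7` in `B(N - 2m - 3)`, bits `ρ · w_j` read off
`j + B(2m+3)` with circuit annulus `j + A_{m+2, 2m+2}` and hole `j + B(m)`, revealment by the
boundary explorer of `B(M)`, two-arm radii `a = 2m+5`, `b = M - N - 1`. [cite: SchrammSmirnov2011, Appendix B, proof of Lemma B.1] -/
theorem nonempty_garbanScheme {K₀ N₀ : ℕ} (hK₀ : 2 ≤ K₀) (hN₀ : 1 ≤ N₀)
    (hZ2 : ∀ N : ℕ, N₀ ≤ N →
      ∫ ω, (numCrossingClusters ω N (K₀ * N) : ℝ) ^ 2 ∂(bondPercolation (zdGraph 2) half) ≤ 3)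
    {ρs : ℝ} (hρs : 0 < ρs)
    (hO : ∀ (c : Site 2) (a b : ℕ), 1 ≤ a → a < b → 2 * b ≤ 8 * (b - a) →
      ρs ≤ (bondPercolation (zdGraph 2) half).real (openCircuitInAnnulusAt c a b))
    (hD : ∀ (c : Site 2) (a b : ℕ), 1 ≤ a → a < b → 2 * b ≤ 8 * (b - a) →
      ρs ≤ (bondPercolation (zdGraph 2) half).real (dualCircuitInAnnulusAt c a b))
    {m n : ℕ} (hm : 1 ≤ m) (hmn : 200 * (K₀ + 1) * N₀ * m ≤ n) :
    Nonempty (GarbanScheme (1 / (44 * ((K₀ : ℝ) + 1)) ^ 2) (2 / ρs) 1 (28 * ((K₀ : ℝ) + 1)) m n) := by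
  -- scales, as opaque naturals with their defining equations
  obtain ⟨N, hNdef⟩ : ∃ N : ℕ, N = n / (K₀ + 1) := ⟨_, rfl⟩
  obtain ⟨M, hMdef⟩ : ∃ M : ℕ, M = K₀ * N := ⟨_, rfl⟩
  obtain ⟨ρ, hρdef⟩ : ∃ ρ : ℕ, ρ = 2 * m + 3 := ⟨_, rfl⟩
  obtain ⟨a', ha'def⟩ : ∃ a' : ℕ, a' = m + 2 := ⟨_, rfl⟩
  obtain ⟨b', hb'def⟩ : ∃ b' : ℕ, b' = 2 * m + 2 := ⟨_, rfl⟩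
  obtain ⟨L, hLdef⟩ : ∃ L : ℕ, L = (N - ρ) / (2 * ρ + 1) := ⟨_, rfl⟩
  -- integer bookkeeping
  have hK1 : 0 < K₀ + 1 := by omega
  have hNn : (K₀ + 1) * N ≤ n := by rw [hNdef, mul_comm]; exact Nat.div_mul_le_self n (K₀ + 1)
  have hnN : n < (K₀ + 1) * (N + 1) := by
    rw [hNdef, mul_comm]
    have := Nat.lt_div_mul_add (a := n) hK1
    linarith
  have hbig : 200 * (N₀ * m) ≤ N := by
    rw [hNdef, Nat.le_div_iff_mul_le hK1]
    calc 200 * (N₀ * m) * (K₀ + 1) = 200 * (K₀ + 1) * N₀ * m := by ring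
      _ ≤ n := hmn
  have h1m : m ≤ N₀ * m := Nat.le_mul_of_pos_left m hN₀
  have hNlarge : 199 * m ≤ N := by omega
  have hNN₀ : N₀ ≤ N := by nlinarith
  have hN1 : 1 ≤ N := by omega
  have h2N : 2 * N ≤ M := by rw [hMdef]; exact Nat.mul_le_mul_right _ hK₀
  have hMNn : M + N ≤ n := by rw [hMdef]; linarith
  have hNM : N < M := by omega
  have hρN : ρ ≤ N := by omega
  have hdL : (2 * ρ + 1) * L ≤ N - ρ := by rw [hLdef, mul_comm]; exact Nat.div_mul_le_self _ _
  have hLlarge : N - ρ < (2 * ρ + 1) * (L + 1) := by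
    rw [hLdef, mul_comm]
    have := Nat.lt_div_mul_add (a := N - ρ) (b := 2 * ρ + 1) (by omega)
    linarith
  have hab' : a' < b' := by omega
  have hthin : 2 * b' ≤ 8 * (b' - a') := by omega
  have ha'1 : 1 ≤ a' := by omega
  have hρb1 : ρ = b' + 1 := by omega
  have hρb : ρ + 2 ≤ M - N - 1 := by omega
  set μ := bondPercolation (zdGraph 2) half with hμ
  set J : Finset (Site 2) := gridCentres (2 * ρ + 1) L with hJdef
  -- geometry of the centres
  have hjabs : ∀ j ∈ J, ∀ i, |j i| ≤ (N : ℤ) - ρ := by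
    intro j hj i
    have h1 := abs_apply_le_of_mem_gridCentres hj i
    have h2 : (((2 * ρ + 1) * L : ℕ) : ℤ) ≤ ((N - ρ : ℕ) : ℤ) := by exact_mod_cast hdL
    push_cast [Nat.cast_sub hρN] at h1 h2
    linarith
  have hV : ∀ j ∈ J, ∀ x : Site 2, x - j ∈ box 2 ρ → x ∈ box 2 N := by
    intro j hj x hx
    rw [mem_box] at hx ⊢
    intro i
    have h1 := hx i
    have h2 := hjabs j hj i
    simp only [Pi.sub_apply] at h1
    cases abs_cases (j i) <;> constructor <;> omega
  have hb : ∀ j ∈ J, ∀ i, (b' : ℤ) + 2 + |j i| ≤ M := by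
    intro j hj i
    have h2 := hjabs j hj i
    have hM2 : 2 * (N : ℤ) ≤ M := by exact_mod_cast h2N
    have : (b' : ℤ) + 2 + ρ ≤ N := by
      have : b' + 2 + ρ ≤ N := by omega
      exact_mod_cast this
    linarith
  have hn4 : ∀ j ∈ J, ∀ i, (M : ℤ) + |j i| ≤ n := by
    intro j hj i
    have h2 := hjabs j hj i
    have : (M : ℤ) + N ≤ n := by exact_mod_cast hMNn
    have hρ0 : (0 : ℤ) ≤ ρ := by positivity
    linarith
  have hbrev : ∀ j ∈ J, ∀ i, ((M - N - 1 : ℕ) : ℤ) + 1 + |j i| ≤ M := by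
    intro j hj i
    have h2 := hjabs j hj i
    push_cast [Nat.cast_sub (show 1 ≤ M - N by omega), Nat.cast_sub hNM.le]
    have hρ0 : (0 : ℤ) ≤ ρ := by positivity
    linarith
  -- the circuit probabilities
  have hpO : ∀ j : Site 2, ρs ≤ μ.real (openCircuitInAnnulusAt j a' b') := fun j => hO j a' b' ha'1 hab' hthin
  have hpD : ∀ j : Site 2, ρs ≤ μ.real (dualCircuitInAnnulusAt j a' b') := fun j => hD j a' b' ha'1 hab' hthin
  -- the objects
  set Zf : BondConfig (Site 2) → ℝ := fun ω => (numCrossingClusters ω N M : ℝ) with hZf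
  set X : BondConfig (Site 2) → ℝ := fun ω => Zf ω / 2 with hX
  set ψ : Site 2 → Finset (Sym2 (Site 2)) → ℝ := fun j o =>
    ρs * circuitWeight j a' b' (μ.real (openCircuitInAnnulusAt j a' b')) (μ.real (dualCircuitInAnnulusAt j a' b')) o
    with hψ
  set C : Site 2 → BondConfig (Site 2) → ℝ := fun j ω => ψ j (obs ω (blockPairs j ρ)) with hC
  set V : Site 2 → Set (BondConfig (Site 2)) := fun j =>
    {ω | ∃ e ∈ blockPairs j ρ, e ∈ supp ((boundaryExplorer M).hist (termTime M) ω)} with hVdef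
  -- measurability and bounds of `X`
  have hZm : Measurable Zf := measurable_numCrossingClusters_real N M
  have hZb : ∀ ω, |Zf ω| ≤ (box 2 N).card := fun ω => by
    simp only [hZf]; rw [Nat.abs_cast]; exact_mod_cast numCrossingClusters_le_card ω N M
  have hXm : Measurable X := hZm.div_const 2
  have hXb : ∀ ω, |X ω| ≤ (box 2 N).card := fun ω => by
    simp only [hX]; rw [abs_div, abs_two]
    have := hZb ω
    have : (0 : ℝ) ≤ |Zf ω| := abs_nonneg _
    linarith
  -- the fields
  have f_card : 1 / (44 * ((K₀ : ℝ) + 1)) ^ 2 * ((n : ℝ) / m) ^ 2 ≤ (J.card : ℝ) := by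
    rw [hJdef, card_gridCentres (by omega) L]
    exact card_bound_aux hN₀ hm hmn hnN hρdef hLlarge hρN
  have f_memLp : MemLp X 2 μ :=
    MemLp.of_bound hXm.aestronglyMeasurable _ (ae_of_all _ fun ω => by rw [Real.norm_eq_abs]; exact hXb ω)
  have f_sq : ∫ ω, X ω ^ 2 ∂μ ≤ 1 := by
    have hsq : ∀ ω, X ω ^ 2 = (1 / 4) * Zf ω ^ 2 := fun ω => by simp only [hX]; ring
    simp_rw [hsq]
    rw [integral_const_mul]
    have := hZ2 N hNN₀
    rw [← hMdef] at this
    simp only [hZf]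
    linarith
  have f_meas : ∀ j ∈ J, AEStronglyMeasurable (C j) μ := fun j _ =>
    (measurable_comp_obs (blockPairs j ρ) (ψ j)).aestronglyMeasurable
  have f_abs : ∀ j ∈ J, ∀ ω, |C j ω| ≤ 1 := by
    intro j _ ω
    simp only [hC, hψ]
    rw [abs_mul, abs_of_pos hρs]
    have := abs_circuitWeight_le (j := j) (a' := a') (b' := b') hρs (hpO j) (hpD j) (obs ω (blockPairs j ρ))
    calc ρs * |circuitWeight j a' b' (μ.real (openCircuitInAnnulusAt j a' b')) (μ.real (dualCircuitInAnnulusAt j a' b'))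
          (obs ω (blockPairs j ρ))| ≤ ρs * (1 / ρs) := mul_le_mul_of_nonneg_left this hρs.le
      _ = 1 := by field_simp
  have f_measV : ∀ j ∈ J, MeasurableSet (V j) := fun j _ =>
    (boundaryExplorer M).measurableSet_setOf_hist' (termTime M) fun h => ∃ e ∈ blockPairs j ρ, e ∈ supp h
  have h0 : ∀ j : Site 2, ∫ ω, ψ j (obs ω (blockPairs j ρ)) ∂μ = 0 := by
    intro j
    simp only [hψ]
    rw [integral_const_mul, hρb1, integral_circuitWeight_obs rfl (hρs.trans_le (hpO j)) rfl (hρs.trans_le (hpD j)),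
      mul_zero]
  have f_orth : ∀ i ∈ J, ∀ j ∈ J, i ≠ j →
      ∫ ω, (V i).indicator (C i) ω * (V j).indicator (C j) ω ∂μ = 0 := by
    intro i hi j hj hij
    exact (boundaryExplorer M).integral_revealedBits_mul_eq_zero (zdGraph 2) half (boundaryExplorer_fresh M)
      (termTime M) (disjoint_blockPairs_of_mem_gridCentres hi hj hij) (ψ i) (ψ j) (h0 i) (h0 j)
  have f_sep : ∀ j ∈ J, μ.real (fourArmTwoClusters m n) ≤ 2 / ρs * ∫ ω in V j, X ω * C j ω ∂μ := by
    intro j hj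
    have hpO0 : 0 < μ.real (openCircuitInAnnulusAt j a' b') := hρs.trans_le (hpO j)
    have hpD0 : 0 < μ.real (dualCircuitInAnnulusAt j a' b') := hρs.trans_le (hpD j)
    have hkey := real_fourArm_le_setIntegral_mul_circuitWeight (N := N) (M := M) hNM (j := j) (h := m) (a' := a')
      (b' := b') (n₄ := n) hm (by omega) hab'.le (by rw [← hρb1]; exact hV j hj) (hb j hj) (hn4 j hj)
      rfl hpO0 rfl hpD0
    rw [real_fourArmTwoClustersAt, ← hρb1] at hkey
    have hXC : ∀ ω, X ω * C j ω = (ρs / 2) * ((numCrossingClusters ω N M : ℝ) *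
        circuitWeight j a' b' (μ.real (openCircuitInAnnulusAt j a' b')) (μ.real (dualCircuitInAnnulusAt j a' b'))
          (obs ω (blockPairs j ρ))) := fun ω => by
      simp only [hX, hC, hψ, hZf]; ring
    simp_rw [hXC]
    rw [integral_const_mul, ← mul_assoc, show (2 : ℝ) / ρs * (ρs / 2) = 1 from by field_simp, one_mul]
    exact hkey
  have f_ratio : (((ρ + 2 : ℕ)) : ℝ) / ((M - N - 1 : ℕ) : ℝ) ≤ 28 * ((K₀ : ℝ) + 1) * m / n := by
    have : ρ + 2 = 2 * m + 5 := by omega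
    rw [this]
    exact ratio_bound_aux hK₀ hN₀ hm hmn hnN hMdef (by omega)
  have f_reveal : ∀ j ∈ J, μ.real (V j) ≤ 1 * μ.real (twoArmOpenDual (ρ + 2) (M - N - 1)) := by
    intro j hj
    rw [one_mul]
    exact real_setOf_exists_mem_supp_le_twoArmOpenDual half (termTime M) hρb (hbrev j hj)
  refine ⟨⟨J, X, C, V, ρ + 2, M - N - 1, f_card, f_memLp, f_sq, f_meas, f_abs, f_measV, f_orth, f_sep, ?_, hρb,
    f_ratio, f_reveal⟩⟩
  omega

/-! ### The discharge -/

/-- **Garban's multi-scale four-arm bound, discharged** (Schramm–Smirnov 2011, Appendix B,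
Lemma B.1; van den Berg–Nolin 2020, Lemma 8): for critical bond percolation on `ℤ²`, if
`π₂(m,n) ≤ c'(m/n)^{2ε}` for all `1 ≤ m ≤ n` then `π₄(m,n) ≤ c (m/n)^{1+ε}` for all `1 ≤ m ≤ n`.
The proof formalised here follows Garban's two-layer revealment scheme with van den Berg–Nolin's
cluster count, the pivotal block inside the circuit annulus and the boundary-interface explorer,
and uses no arm-separation theorem (module docstring). [cite: SchrammSmirnov2011, Appendix B, Lemma B.1] -/
theorem Garban2011_fourArm_multiscale_holds : Garban2011_fourArm_multiscale := by
  obtain ⟨K₀, N₀, hK₀, hN₀, hZ2⟩ := exists_integral_numCrossingClusters_sq_le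
  obtain ⟨ρO, hρO, hO⟩ := exists_pos_le_real_openCircuitInAnnulusAt (k := 8) (by norm_num)
  obtain ⟨ρD, hρD, hD⟩ := exists_pos_le_real_dualCircuitInAnnulusAt_half (k := 8) (by norm_num)
  have hρs : 0 < min ρO ρD := lt_min hρO hρD
  refine Garban2011_fourArm_multiscale_of_scheme (K₁ := 1 / (44 * ((K₀ : ℝ) + 1)) ^ 2) (K₂ := 2 / min ρO ρD)
    (K₃ := 1) (K₄ := 28 * ((K₀ : ℝ) + 1)) (by positivity) (by positivity) zero_le_one (by positivity)
    (C₀ := 200 * (K₀ + 1) * N₀) (by nlinarith) fun m n hm hmn => ?_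
  exact nonempty_garbanScheme hK₀ hN₀ hZ2 hρs
    (fun c a b ha hab hk => (min_le_left _ _).trans (hO c a b ha hab hk))
    (fun c a b ha hab hk => (min_le_right _ _).trans (hD c a b ha hab hk)) hm hmn

end Literature.Probability.Percolation
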